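import Mathlib
import HarnessLib
import Summits.Ventures.LatticeQCDFlow.Exactness.SU2LeapfrogEnergyError
import Summits.Ventures.LatticeQCDFlow.Exactness.SU2ExactForceCovering
import Summits.Ventures.LatticeQCDFlow.Exactness.SU2WilsonFlowLOAcceptanceLattice

/-!
# THE «ACCEPTANCE VS STEP SIZE» LAW OF FT-HMC THROUGH THE `SU(2)` LO WILSON-FLOW MEMBER WITH THE EXACT FORCE AS RUN: the energy error of the engine's `n`-step proposal with the consistent half kick is `O(nε'²)` with every factor of the step size explicit — any torus, any schedule; the row's 4⁴ acceptance configuration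

HONEST FRAMING: exact (Metropolis-corrected) sampling algorithms for lattice gauge theory;
figures of merit are autocorrelation/cost numbers at stated couplings and volumes; no
continuum-physics claim.

Venture `LatticeQCDFlow` (cell pub-lqcd), topic `Exactness`; FANOUT row 14 (`eng-flowhmc`, engine
`latflow.fthmc`, family B; the row's acceptance test: the LO Wilson-flow member inside HMC on the 4⁴
`SU(2)` lattice with the force by autodiff of the pulled-back action, `nstep ≥ 1` leapfrog steps; test
columns «acceptance vs step size», `⟨e^{−ΔH}⟩ = 1`).  NEW WORK of the cell over the tree:
`SU2LeapfrogEnergyError` (the energy error of the engine's `n`-step `SU(2)` proposal for ANY action with a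
bounded, matrix-sup-Lipschitz coordinate gradient `D^ε S` along the drift `e_ε`, consistent half kick
`−D^ε S/(4κ')`), `SU2ExpDriftWork` (`su2ExpDrift`, the drift calculus), `SU2WilsonFlowLOExactForceRegular`
(`su2WilsonFlowLO_exactForce_regular`: the exact force `Φ_κ(V)_l = κ·(∂_{a_l^i} S̃(exp(a)·V)|₀)_i` through the
LO member is measurable, bounded, Lipschitz in `‖coeConfig V − coeConfig V'‖`), `SU2ExactForceCovering`
(`differentiableAt_ftAction_su2WilsonFlowLO_pauliDrift`), `SU2WilsonFlowLOSchedule` / `WilsonFlowMasks` /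
`SU2WilsonFlowLOAcceptanceLattice` (`exists_layers_su2WilsonFlowLO`, `exists_parityMask`,
`length_luscherSchedule_four`), row 9's kernel of record `SU2MultiStepLeapfrogHMC` (`sunLeapfrogProposalN
pauliCoordι …` — the proposal inside `su2LeapfrogHMCN ε' κ' hg S̃ n`, the kernel of
`SU2WilsonFlowLOExactForceFTHMCN`); nothing is cited as a fact; no number.

* §1 `action_su2ExpDrift_eq_comp`, `hasFDerivAt_action_su2ExpDrift`, `differentiableAt_action_su2ExpDrift`,
  `fderiv_action_su2ExpDrift_apply`, **`su2Grad_eq_smul_unitGrad`** — THE CHAIN RULE IN THE STEP SIZE for ANY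
  action on any finite link set: `a ↦ S(e_ε(a)·W)` is `a ↦ S(exp(a)·W)` after `a ↦ εa` (definitionally), so
  differentiability along `e_ε` at `0` follows from differentiability along `exp` (the form the tree types), and
  `D^ε S(W)_l = ε·D¹S(W)_l` — for the exact force `Φ_κ = κ·D¹S̃`: `D^ε S̃ = (ε/κ)Φ_κ`.
* §2 **`abs_su2LeapfrogProposalN_energy_error_le_of_unitGrad`** — for ANY action with `a ↦ S(exp(a)·W)`
  differentiable at `0`, `‖D¹S(W)_l‖ ≤ B`, `‖D¹S(W) − D¹S(W')‖ ≤ K‖coeConfig W − coeConfig W'‖` (the format in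
  which the tree delivers `Φ₁`), drift `e_{ε'}`, kinetic coefficient `κ' > 0`, CONSISTENT half kick
  `g = −(ε'/(4κ'))·D¹S` (= `−(ε'/2)·Φ_κ` exactly when `2κκ' = 1`):
  `|H(Ψ_n(q,p)) − H(q,p)| ≤ n·(|ε'|K)·(‖p‖ + (2n+1)|ε'|B/(4κ'))·|ε'|·(8(Σ_l‖p_l‖ + (2n+1)|ι||ε'|B/(4κ')) + |ι||ε'|B/κ')`
  — `O(nε'²)` with every factor of `ε'` visible.
* §3 **`su2WilsonFlowLO_exactForce_leapfrogN_energy_error`** — THE LO MEMBER: torus `(ℤ/L)^d`, colouring `χ`,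
  ANY schedule (layers packaged VERBATIM as in `exists_layers_su2WilsonFlowLO`, positive densities), every `β`,
  `κ' > 0`: there are `Φ_max, K_Φ ≥ 0` (the constants of `su2WilsonFlowLO_exactForce_regular` at `κ = 1`) bounding
  `D¹S̃` and its matrix-sup Lipschitz constant, and FOR EVERY `n`, `ε'`, `q`, `p` the energy error of the
  engine's `n`-step proposal driven by `−(ε'/(4κ'))·D¹S̃` obeys the §2 bound with `B = Φ_max`, `K = K_Φ`.
* §4 **`su2_fthmcN_acceptanceLattice_exactForce_energy_error`** — THE ROW'S ACCEPTANCE CONFIGURATION: 4⁴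
  `SU(2)`, a parity colouring, Lüscher's sweep schedule (`8·nsweeps` masked LO sub-steps), refusal rule
  `6|ε| < 1`: the same, with `|ι| = |Edge 4 4|`.
So the «acceptance vs step size» column of the row's test battery has a typed law on the `SU(2)` rung: at
fixed trajectory length `τ = nε'` the energy error of the exact kernel's proposal is `O(τε')` pointwise in
`(q, p)`, and the acceptance probability is `≥ exp(−that)`.

NOT CLAIMED: any value of `Φ_max`, `K_Φ` (compactness constants; for constants independent of the side see
`SU2ExactForceRegularUniform` — not instantiated here); the mean acceptance under the Gibbs law (Gaussian
moment of `Σ‖p_l‖`); optimal constants; the learned member (`SU2ResidualExactForceRegular` delivers the same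
format under (ρD) — not instantiated here); OMF words; floating point; any number.
-/

noncomputable section

namespace Summit.Ventures.LatticeQCDFlow.Exactness

open Set Function MeasureTheory NormedSpace InnerProductGeometry
open Literature.MathematicalPhysics.QuantumFieldTheory
open Literature.MathematicalPhysics.QuantumFieldTheory.Balaban1983to89.B10Eq18SigmaSU2Haar (expPauli)
open scoped Matrix Matrix.Norms.Operator InnerProductSpace

set_option backward.isDefEq.respectTransparency false

variable {ι : Type*}

/-! ## §1 The chain rule in the step size: `D^ε S = ε·D¹S`, and differentiability along `e_ε` from differentiability along `e_1` -/

section ChainRule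

/-- `a ↦ S(e_ε(a)·W)` is `a ↦ S(exp(a)·W)` precomposed with `a ↦ εa` (definitionally). -/
theorem action_su2ExpDrift_eq_comp (S : (ι → Matrix.specialUnitaryGroup (Fin 2) ℂ) → ℝ) (ε : ℝ)
    (W : ι → Matrix.specialUnitaryGroup (Fin 2) ℂ) :
    (fun a : ι → EuclideanSpace ℝ (Fin 3) => S (su2ExpDrift ε a * W)) =
      (fun a : ι → EuclideanSpace ℝ (Fin 3) => S ((fun l : ι => expPauli (a l)) * W)) ∘ fun a : ι → EuclideanSpace ℝ (Fin 3) => ε • a :=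
  rfl

variable [Fintype ι]

/-- **Differentiability along `e_ε` at zero momentum follows from differentiability along `e_1`** (the form in
which `SU2WilsonFlowLOContDiff` / `SU2ResidualExactForceCovering` type it for the two members). -/
theorem hasFDerivAt_action_su2ExpDrift (S : (ι → Matrix.specialUnitaryGroup (Fin 2) ℂ) → ℝ) (ε : ℝ)
    (W : ι → Matrix.specialUnitaryGroup (Fin 2) ℂ)
    (hd1 : DifferentiableAt ℝ (fun a : ι → EuclideanSpace ℝ (Fin 3) => S ((fun l : ι => expPauli (a l)) * W)) 0) :
    HasFDerivAt (fun a : ι → EuclideanSpace ℝ (Fin 3) => S (su2ExpDrift ε a * W))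
      ((fderiv ℝ (fun a : ι → EuclideanSpace ℝ (Fin 3) => S ((fun l : ι => expPauli (a l)) * W)) 0).comp
        (ε • ContinuousLinearMap.id ℝ (ι → EuclideanSpace ℝ (Fin 3)))) 0 := by
  have h0 : (fun a : ι → EuclideanSpace ℝ (Fin 3) => ε • a) 0 = 0 := smul_zero ε
  have hO : HasFDerivAt (fun a : ι → EuclideanSpace ℝ (Fin 3) => S ((fun l : ι => expPauli (a l)) * W))
      (fderiv ℝ (fun a : ι → EuclideanSpace ℝ (Fin 3) => S ((fun l : ι => expPauli (a l)) * W)) 0)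
      ((fun a : ι → EuclideanSpace ℝ (Fin 3) => ε • a) 0) := by
    rw [h0]
    exact hd1.hasFDerivAt
  rw [action_su2ExpDrift_eq_comp]
  exact hO.comp (0 : ι → EuclideanSpace ℝ (Fin 3)) ((hasFDerivAt_id (0 : ι → EuclideanSpace ℝ (Fin 3))).const_smul ε)

/-- Differentiability along `e_ε` at zero momentum. -/
theorem differentiableAt_action_su2ExpDrift (S : (ι → Matrix.specialUnitaryGroup (Fin 2) ℂ) → ℝ) (ε : ℝ)
    (W : ι → Matrix.specialUnitaryGroup (Fin 2) ℂ)
    (hd1 : DifferentiableAt ℝ (fun a : ι → EuclideanSpace ℝ (Fin 3) => S ((fun l : ι => expPauli (a l)) * W)) 0) :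
    DifferentiableAt ℝ (fun a : ι → EuclideanSpace ℝ (Fin 3) => S (su2ExpDrift ε a * W)) 0 :=
  (hasFDerivAt_action_su2ExpDrift S ε W hd1).differentiableAt

/-- **THE CHAIN RULE IN THE STEP SIZE**: `D(a ↦ S(e_ε(a)·W))(0)[v] = ε · D(a ↦ S(exp(a)·W))(0)[v]`. -/
theorem fderiv_action_su2ExpDrift_apply (S : (ι → Matrix.specialUnitaryGroup (Fin 2) ℂ) → ℝ) (ε : ℝ)
    (W : ι → Matrix.specialUnitaryGroup (Fin 2) ℂ)
    (hd1 : DifferentiableAt ℝ (fun a : ι → EuclideanSpace ℝ (Fin 3) => S ((fun l : ι => expPauli (a l)) * W)) 0)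
    (v : ι → EuclideanSpace ℝ (Fin 3)) :
    fderiv ℝ (fun a : ι → EuclideanSpace ℝ (Fin 3) => S (su2ExpDrift ε a * W)) 0 v =
      ε * fderiv ℝ (fun a : ι → EuclideanSpace ℝ (Fin 3) => S ((fun l : ι => expPauli (a l)) * W)) 0 v := by
  rw [(hasFDerivAt_action_su2ExpDrift S ε W hd1).fderiv, ContinuousLinearMap.comp_apply,
    show (ε • ContinuousLinearMap.id ℝ (ι → EuclideanSpace ℝ (Fin 3))) v = ε • v from rfl, map_smul, smul_eq_mul]

/-- **`D^ε S(W)_l = ε · D¹S(W)_l`** — the coordinate gradient along `e_ε` is `ε` times the unit-step gradient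
(so for the tree's exact force `Φ_κ = κ·D¹S̃`: `D^ε S̃ = (ε/κ)Φ_κ`). -/
theorem su2Grad_eq_smul_unitGrad [DecidableEq ι] (S : (ι → Matrix.specialUnitaryGroup (Fin 2) ℂ) → ℝ) (ε : ℝ)
    (W : ι → Matrix.specialUnitaryGroup (Fin 2) ℂ)
    (hd1 : DifferentiableAt ℝ (fun a : ι → EuclideanSpace ℝ (Fin 3) => S ((fun l : ι => expPauli (a l)) * W)) 0) (l : ι) :
    WithLp.toLp 2 (fun i : Fin 3 => fderiv ℝ (fun a : ι → EuclideanSpace ℝ (Fin 3) => S (su2ExpDrift ε a * W)) 0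
        (Pi.single l (EuclideanSpace.single i (1 : ℝ)))) =
      ε • WithLp.toLp 2 (fun i : Fin 3 => fderiv ℝ (fun a : ι → EuclideanSpace ℝ (Fin 3) => S ((fun l : ι => expPauli (a l)) * W)) 0
        (Pi.single l (EuclideanSpace.single i (1 : ℝ)))) := by
  rw [← WithLp.toLp_smul]
  congr 1
  funext i
  rw [Pi.smul_apply, smul_eq_mul, fderiv_action_su2ExpDrift_apply S ε W hd1]

end ChainRule

/-! ## §2 The energy error of the engine's `n`-step `SU(2)` proposal driven by a bounded, matrix-sup-Lipschitz unit-step gradient, with the consistent half kick `−(ε/(4κ'))·D¹S` -/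

section UnitForce

variable [Fintype ι] [DecidableEq ι]

/-- **THE «ACCEPTANCE VS STEP SIZE» LAW FOR A KERNEL DRIVEN BY THE UNIT-STEP GRADIENT.**  Let `S` be any action
with `a ↦ S(exp(a)·W)` differentiable at `0` for every `W`, and let its unit-step coordinate gradient
`D¹S(W)_l = (∂_{a_l^i} S(exp(a)·W)|₀)_i` satisfy `‖D¹S(W)_l‖ ≤ B` and `‖D¹S(W) − D¹S(W')‖ ≤ K‖coeConfig W − coeConfig W'‖`
(the format in which `SU2WilsonFlowLOExactForceRegular` / `SU2ResidualExactForceRegular` deliver the exact force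
`Φ_κ = κ·D¹S̃`, `κ = 1`).  Then for the engine's `n`-step proposal with drift `e_ε`, kinetic coefficient `κ' > 0` and
the CONSISTENT half kick `g = −(ε/(4κ'))·D¹S`:
`|H(Ψ_n(q,p)) − H(q,p)| ≤ n·(|ε|K)·(‖p‖ + (2n+1)|ε|B/(4κ'))·|ε|·(8(Σ_l‖p_l‖ + (2n+1)|ι||ε|B/(4κ')) + |ι||ε|B/κ')`
— EXPLICITLY `O(nε²)`: every factor of the step size is visible. -/
theorem abs_su2LeapfrogProposalN_energy_error_le_of_unitGrad (S : (ι → Matrix.specialUnitaryGroup (Fin 2) ℂ) → ℝ)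
    (ε κ' : ℝ) (hκ' : 0 < κ')
    (hd1 : ∀ W : ι → Matrix.specialUnitaryGroup (Fin 2) ℂ,
      DifferentiableAt ℝ (fun a : ι → EuclideanSpace ℝ (Fin 3) => S ((fun l : ι => expPauli (a l)) * W)) 0)
    {B K : ℝ} (hB0 : 0 ≤ B) (hK0 : 0 ≤ K)
    (hb : ∀ (W : ι → Matrix.specialUnitaryGroup (Fin 2) ℂ) (l : ι),
      ‖WithLp.toLp 2 (fun i : Fin 3 => fderiv ℝ (fun a : ι → EuclideanSpace ℝ (Fin 3) => S ((fun l : ι => expPauli (a l)) * W)) 0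
        (Pi.single l (EuclideanSpace.single i (1 : ℝ))))‖ ≤ B)
    (hK : ∀ W W' : ι → Matrix.specialUnitaryGroup (Fin 2) ℂ,
      ‖(fun l : ι => WithLp.toLp 2 (fun i : Fin 3 => fderiv ℝ (fun a : ι → EuclideanSpace ℝ (Fin 3) => S ((fun l : ι => expPauli (a l)) * W)) 0
          (Pi.single l (EuclideanSpace.single i (1 : ℝ))))) -
        (fun l : ι => WithLp.toLp 2 (fun i : Fin 3 => fderiv ℝ (fun a : ι → EuclideanSpace ℝ (Fin 3) => S ((fun l : ι => expPauli (a l)) * W')) 0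
          (Pi.single l (EuclideanSpace.single i (1 : ℝ)))))‖ ≤ K * ‖coeConfig W - coeConfig W'‖)
    (q : ι → Matrix.specialUnitaryGroup (Fin 2) ℂ) (p : ι → EuclideanSpace ℝ (Fin 3)) (n : ℕ) :
    |(S (sunLeapfrogProposalN pauliCoordι pauliCoordι_skew ε (fun (W : ι → Matrix.specialUnitaryGroup (Fin 2) ℂ) (l : ι) =>
          -(ε / (4 * κ')) • WithLp.toLp 2 (fun i : Fin 3 => fderiv ℝ (fun a : ι → EuclideanSpace ℝ (Fin 3) => S ((fun l : ι => expPauli (a l)) * W)) 0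
            (Pi.single l (EuclideanSpace.single i (1 : ℝ))))) n (q, p)).1 +
        su2Kinetic κ' (sunLeapfrogProposalN pauliCoordι pauliCoordι_skew ε (fun (W : ι → Matrix.specialUnitaryGroup (Fin 2) ℂ) (l : ι) =>
          -(ε / (4 * κ')) • WithLp.toLp 2 (fun i : Fin 3 => fderiv ℝ (fun a : ι → EuclideanSpace ℝ (Fin 3) => S ((fun l : ι => expPauli (a l)) * W)) 0
            (Pi.single l (EuclideanSpace.single i (1 : ℝ))))) n (q, p)).2) -
      (S q + su2Kinetic κ' p)| ≤
      n * ((|ε| * K) * (‖p‖ + (2 * n + 1) * (|ε| * B / (4 * κ'))) * |ε| *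
        (8 * (∑ l, ‖p l‖ + (2 * n + 1) * (Fintype.card ι * (|ε| * B / (4 * κ')))) + Fintype.card ι * (|ε| * B) / κ')) := by
  -- the hypotheses of `abs_su2LeapfrogProposalN_energy_error_le` for `D^ε S = ε·D¹S`
  have hd : ∀ W : ι → Matrix.specialUnitaryGroup (Fin 2) ℂ,
      DifferentiableAt ℝ (fun a : ι → EuclideanSpace ℝ (Fin 3) => S (su2ExpDrift ε a * W)) 0 :=
    fun W => differentiableAt_action_su2ExpDrift S ε W (hd1 W)
  have hgrad := fun W => su2Grad_eq_smul_unitGrad S ε W (hd1 W)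
  have hDb : ∀ (W : ι → Matrix.specialUnitaryGroup (Fin 2) ℂ) (l : ι),
      ‖WithLp.toLp 2 (fun i : Fin 3 => fderiv ℝ (fun a : ι → EuclideanSpace ℝ (Fin 3) => S (su2ExpDrift ε a * W)) 0
        (Pi.single l (EuclideanSpace.single i (1 : ℝ))))‖ ≤ |ε| * B := by
    intro W l
    rw [hgrad W l, norm_smul, Real.norm_eq_abs]
    exact mul_le_mul_of_nonneg_left (hb W l) (abs_nonneg ε)
  have hfun : ∀ W : ι → Matrix.specialUnitaryGroup (Fin 2) ℂ,
      (fun l : ι => WithLp.toLp 2 (fun i : Fin 3 => fderiv ℝ (fun a : ι → EuclideanSpace ℝ (Fin 3) => S (su2ExpDrift ε a * W)) 0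
          (Pi.single l (EuclideanSpace.single i (1 : ℝ))))) =
        ε • (fun l : ι => WithLp.toLp 2 (fun i : Fin 3 => fderiv ℝ (fun a : ι → EuclideanSpace ℝ (Fin 3) => S ((fun l : ι => expPauli (a l)) * W)) 0
          (Pi.single l (EuclideanSpace.single i (1 : ℝ))))) := by
    intro W
    funext l
    rw [Pi.smul_apply, hgrad W l]
  have hDK : ∀ W W' : ι → Matrix.specialUnitaryGroup (Fin 2) ℂ,
      ‖(fun l : ι => WithLp.toLp 2 (fun i : Fin 3 => fderiv ℝ (fun a : ι → EuclideanSpace ℝ (Fin 3) => S (su2ExpDrift ε a * W)) 0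
          (Pi.single l (EuclideanSpace.single i (1 : ℝ))))) -
        (fun l : ι => WithLp.toLp 2 (fun i : Fin 3 => fderiv ℝ (fun a : ι → EuclideanSpace ℝ (Fin 3) => S (su2ExpDrift ε a * W')) 0
          (Pi.single l (EuclideanSpace.single i (1 : ℝ)))))‖ ≤ (|ε| * K) * ‖coeConfig W - coeConfig W'‖ := by
    intro W W'
    rw [hfun W, hfun W', ← smul_sub, norm_smul, Real.norm_eq_abs, mul_assoc]
    exact mul_le_mul_of_nonneg_left (hK W W') (abs_nonneg ε)
  -- the consistent half kick of `SU2LeapfrogEnergyError` IS `−(ε/(4κ'))·D¹S`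
  have hkick : (fun (W : ι → Matrix.specialUnitaryGroup (Fin 2) ℂ) (l : ι) =>
        -(1 / (4 * κ')) • WithLp.toLp 2 (fun i : Fin 3 => fderiv ℝ (fun a : ι → EuclideanSpace ℝ (Fin 3) => S (su2ExpDrift ε a * W)) 0
          (Pi.single l (EuclideanSpace.single i (1 : ℝ))))) =
      (fun (W : ι → Matrix.specialUnitaryGroup (Fin 2) ℂ) (l : ι) =>
        -(ε / (4 * κ')) • WithLp.toLp 2 (fun i : Fin 3 => fderiv ℝ (fun a : ι → EuclideanSpace ℝ (Fin 3) => S ((fun l : ι => expPauli (a l)) * W)) 0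
          (Pi.single l (EuclideanSpace.single i (1 : ℝ))))) := by
    funext W l
    rw [hgrad W l, smul_smul]
    congr 1
    ring
  have h := abs_su2LeapfrogProposalN_energy_error_le S ε κ' hκ' hd (by positivity : 0 ≤ |ε| * B) (by positivity : 0 ≤ |ε| * K)
    hDb hDK q p n
  rw [hkick] at h
  exact h

end UnitForce

/-! ## §3 The LO Wilson-flow member on any torus, any schedule -/

section Member

variable {d L : ℕ} {X : Type*} [DecidableEq X] (χ : Site d L → X) [NeZero L]

/-- **THE «ACCEPTANCE VS STEP SIZE» LAW OF FT-HMC THROUGH THE `SU(2)` LO MEMBER WITH THE EXACT FORCE AS RUN.**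
Torus `(ℤ/L)^d`, colouring `χ`, ANY schedule (layers packaged VERBATIM, positive densities), every `β`, kinetic
coefficient `κ' > 0`: there are `Φ_max, K_Φ ≥ 0` with `‖D¹S̃(V)_l‖ ≤ Φ_max`,
`‖D¹S̃(V) − D¹S̃(V')‖ ≤ K_Φ‖coeConfig V − coeConfig V'‖` (`D¹S̃ = Φ₁`, the exact force at scale `1`), and for EVERY
`n`, `ε'`, `q`, `p` the energy error of the engine's `n`-step proposal with drift `e_{ε'}` and the consistent half
kick `−(ε'/(4κ'))·D¹S̃` is at most
`n·(|ε'|K_Φ)·(‖p‖ + (2n+1)|ε'|Φ_max/(4κ'))·|ε'|·(8(Σ_l‖p_l‖ + (2n+1)|E||ε'|Φ_max/(4κ')) + |E||ε'|Φ_max/κ')`. -/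
theorem su2WilsonFlowLO_exactForce_leapfrogN_energy_error (ε : ℝ) (sched : List (Fin d × X))
    (layers : List ((GaugeConfig d L (Matrix.specialUnitaryGroup (Fin 2) ℂ) ≃ᵐ GaugeConfig d L (Matrix.specialUnitaryGroup (Fin 2) ℂ)) × (GaugeConfig d L (Matrix.specialUnitaryGroup (Fin 2) ℂ) → ℝ)))
    (hmap :
      layers.map (fun Ly => ((Ly.1 : GaugeConfig d L (Matrix.specialUnitaryGroup (Fin 2) ℂ) → GaugeConfig d L (Matrix.specialUnitaryGroup (Fin 2) ℂ)), Ly.2)) =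
        sched.map (fun s =>
        ((fun (V : GaugeConfig d L (Matrix.specialUnitaryGroup (Fin 2) ℂ)) (e : Edge d L) =>
        if e.2 = s.1 ∧ χ e.1 = s.2 then
          gaussUnit (geodesicKick ε (∑ ν ∈ Finset.univ.erase e.2,
            (vecQuat (((V (Site.shift e.1 e.2, ν) * (V (Site.shift e.1 ν, e.2))⁻¹ * (V (e.1, ν))⁻¹)⁻¹ : (Matrix.specialUnitaryGroup (Fin 2) ℂ)) : Matrix (Fin 2) (Fin 2) ℂ) +
              vecQuat ((((V (Site.shift (e.1 - Pi.single ν 1) e.2, ν))⁻¹ * (V (e.1 - Pi.single ν 1, e.2))⁻¹ *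
                V (e.1 - Pi.single ν 1, ν))⁻¹ : (Matrix.specialUnitaryGroup (Fin 2) ℂ)) : Matrix (Fin 2) (Fin 2) ℂ)))
            (vecQuat ((V e : (Matrix.specialUnitaryGroup (Fin 2) ℂ)) : Matrix (Fin 2) (Fin 2) ℂ)))
        else V e),
         fun V : GaugeConfig d L (Matrix.specialUnitaryGroup (Fin 2) ℂ) => ∏ a : {e : Edge d L // e.2 = s.1 ∧ χ e.1 = s.2},
          (if Real.sin (angle (∑ ν ∈ Finset.univ.erase a.1.2,
            (vecQuat (((V (Site.shift a.1.1 a.1.2, ν) * (V (Site.shift a.1.1 ν, a.1.2))⁻¹ * (V (a.1.1, ν))⁻¹)⁻¹ : (Matrix.specialUnitaryGroup (Fin 2) ℂ)) : Matrix (Fin 2) (Fin 2) ℂ) +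
              vecQuat ((((V (Site.shift (a.1.1 - Pi.single ν 1) a.1.2, ν))⁻¹ * (V (a.1.1 - Pi.single ν 1, a.1.2))⁻¹ *
                V (a.1.1 - Pi.single ν 1, ν))⁻¹ : (Matrix.specialUnitaryGroup (Fin 2) ℂ)) : Matrix (Fin 2) (Fin 2) ℂ))) (vecQuat ((V a.1 : (Matrix.specialUnitaryGroup (Fin 2) ℂ)) : Matrix (Fin 2) (Fin 2) ℂ))) = 0 then
            (1 - ε * ‖(∑ ν ∈ Finset.univ.erase a.1.2,
            (vecQuat (((V (Site.shift a.1.1 a.1.2, ν) * (V (Site.shift a.1.1 ν, a.1.2))⁻¹ * (V (a.1.1, ν))⁻¹)⁻¹ : (Matrix.specialUnitaryGroup (Fin 2) ℂ)) : Matrix (Fin 2) (Fin 2) ℂ) +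
              vecQuat ((((V (Site.shift (a.1.1 - Pi.single ν 1) a.1.2, ν))⁻¹ * (V (a.1.1 - Pi.single ν 1, a.1.2))⁻¹ *
                V (a.1.1 - Pi.single ν 1, ν))⁻¹ : (Matrix.specialUnitaryGroup (Fin 2) ℂ)) : Matrix (Fin 2) (Fin 2) ℂ)))‖ * Real.cos (angle (∑ ν ∈ Finset.univ.erase a.1.2,
            (vecQuat (((V (Site.shift a.1.1 a.1.2, ν) * (V (Site.shift a.1.1 ν, a.1.2))⁻¹ * (V (a.1.1, ν))⁻¹)⁻¹ : (Matrix.specialUnitaryGroup (Fin 2) ℂ)) : Matrix (Fin 2) (Fin 2) ℂ) +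
              vecQuat ((((V (Site.shift (a.1.1 - Pi.single ν 1) a.1.2, ν))⁻¹ * (V (a.1.1 - Pi.single ν 1, a.1.2))⁻¹ *
                V (a.1.1 - Pi.single ν 1, ν))⁻¹ : (Matrix.specialUnitaryGroup (Fin 2) ℂ)) : Matrix (Fin 2) (Fin 2) ℂ))) (vecQuat ((V a.1 : (Matrix.specialUnitaryGroup (Fin 2) ℂ)) : Matrix (Fin 2) (Fin 2) ℂ)))) ^ 3
          else kickJac (ε * ‖(∑ ν ∈ Finset.univ.erase a.1.2,
            (vecQuat (((V (Site.shift a.1.1 a.1.2, ν) * (V (Site.shift a.1.1 ν, a.1.2))⁻¹ * (V (a.1.1, ν))⁻¹)⁻¹ : (Matrix.specialUnitaryGroup (Fin 2) ℂ)) : Matrix (Fin 2) (Fin 2) ℂ) +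
              vecQuat ((((V (Site.shift (a.1.1 - Pi.single ν 1) a.1.2, ν))⁻¹ * (V (a.1.1 - Pi.single ν 1, a.1.2))⁻¹ *
                V (a.1.1 - Pi.single ν 1, ν))⁻¹ : (Matrix.specialUnitaryGroup (Fin 2) ℂ)) : Matrix (Fin 2) (Fin 2) ℂ)))‖) 2 (angle (∑ ν ∈ Finset.univ.erase a.1.2,
            (vecQuat (((V (Site.shift a.1.1 a.1.2, ν) * (V (Site.shift a.1.1 ν, a.1.2))⁻¹ * (V (a.1.1, ν))⁻¹)⁻¹ : (Matrix.specialUnitaryGroup (Fin 2) ℂ)) : Matrix (Fin 2) (Fin 2) ℂ) +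
              vecQuat ((((V (Site.shift (a.1.1 - Pi.single ν 1) a.1.2, ν))⁻¹ * (V (a.1.1 - Pi.single ν 1, a.1.2))⁻¹ *
                V (a.1.1 - Pi.single ν 1, ν))⁻¹ : (Matrix.specialUnitaryGroup (Fin 2) ℂ)) : Matrix (Fin 2) (Fin 2) ℂ))) (vecQuat ((V a.1 : (Matrix.specialUnitaryGroup (Fin 2) ℂ)) : Matrix (Fin 2) (Fin 2) ℂ)))))))
    (hpos : ∀ Ly ∈ layers, ∀ V, 0 < Ly.2 V) (β κ' : ℝ) (hκ' : 0 < κ') :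
    ∃ Φmax KΦ : ℝ, 0 ≤ Φmax ∧ 0 ≤ KΦ ∧
      (∀ (V : GaugeConfig d L (Matrix.specialUnitaryGroup (Fin 2) ℂ)) (l : Edge d L), ‖WithLp.toLp 2 (fun i : Fin 3 =>
        fderiv ℝ (fun a : Edge d L → EuclideanSpace ℝ (Fin 3) => β * wilsonAction (Matrix.specialUnitaryGroup (Fin 2) ℂ).subtype ((layers.foldr (fun Ly (F : GaugeConfig d L (Matrix.specialUnitaryGroup (Fin 2) ℂ) ≃ᵐ GaugeConfig d L (Matrix.specialUnitaryGroup (Fin 2) ℂ)) => Ly.1.trans F) (MeasurableEquiv.refl (GaugeConfig d L (Matrix.specialUnitaryGroup (Fin 2) ℂ)))) ((fun l : Edge d L => expPauli (a l)) * V)) - Real.log ((layers.foldr (fun Ly K => fun v => Ly.2 v * K (Ly.1 v)) (fun _ => (1 : ℝ))) ((fun l : Edge d L => expPauli (a l)) * V))) 0 (Pi.single l (EuclideanSpace.single i (1 : ℝ))))‖ ≤ Φmax) ∧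
      (∀ V V' : GaugeConfig d L (Matrix.specialUnitaryGroup (Fin 2) ℂ),
        ‖(fun l : Edge d L => WithLp.toLp 2 (fun i : Fin 3 =>
        fderiv ℝ (fun a : Edge d L → EuclideanSpace ℝ (Fin 3) => β * wilsonAction (Matrix.specialUnitaryGroup (Fin 2) ℂ).subtype ((layers.foldr (fun Ly (F : GaugeConfig d L (Matrix.specialUnitaryGroup (Fin 2) ℂ) ≃ᵐ GaugeConfig d L (Matrix.specialUnitaryGroup (Fin 2) ℂ)) => Ly.1.trans F) (MeasurableEquiv.refl (GaugeConfig d L (Matrix.specialUnitaryGroup (Fin 2) ℂ)))) ((fun l : Edge d L => expPauli (a l)) * V)) - Real.log ((layers.foldr (fun Ly K => fun v => Ly.2 v * K (Ly.1 v)) (fun _ => (1 : ℝ))) ((fun l : Edge d L => expPauli (a l)) * V))) 0 (Pi.single l (EuclideanSpace.single i (1 : ℝ))))) - (fun l : Edge d L => WithLp.toLp 2 (fun i : Fin 3 =>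
        fderiv ℝ (fun a : Edge d L → EuclideanSpace ℝ (Fin 3) => β * wilsonAction (Matrix.specialUnitaryGroup (Fin 2) ℂ).subtype ((layers.foldr (fun Ly (F : GaugeConfig d L (Matrix.specialUnitaryGroup (Fin 2) ℂ) ≃ᵐ GaugeConfig d L (Matrix.specialUnitaryGroup (Fin 2) ℂ)) => Ly.1.trans F) (MeasurableEquiv.refl (GaugeConfig d L (Matrix.specialUnitaryGroup (Fin 2) ℂ)))) ((fun l : Edge d L => expPauli (a l)) * V')) - Real.log ((layers.foldr (fun Ly K => fun v => Ly.2 v * K (Ly.1 v)) (fun _ => (1 : ℝ))) ((fun l : Edge d L => expPauli (a l)) * V'))) 0 (Pi.single l (EuclideanSpace.single i (1 : ℝ)))))‖ ≤ KΦ * ‖coeConfig V - coeConfig V'‖) ∧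
      ∀ (n : ℕ) (ε' : ℝ) (q : GaugeConfig d L (Matrix.specialUnitaryGroup (Fin 2) ℂ)) (p : Edge d L → EuclideanSpace ℝ (Fin 3)),
        |(β * wilsonAction (Matrix.specialUnitaryGroup (Fin 2) ℂ).subtype ((layers.foldr (fun Ly (F : GaugeConfig d L (Matrix.specialUnitaryGroup (Fin 2) ℂ) ≃ᵐ GaugeConfig d L (Matrix.specialUnitaryGroup (Fin 2) ℂ)) => Ly.1.trans F) (MeasurableEquiv.refl (GaugeConfig d L (Matrix.specialUnitaryGroup (Fin 2) ℂ)))) (sunLeapfrogProposalN pauliCoordι pauliCoordι_skew ε' (fun (V : GaugeConfig d L (Matrix.specialUnitaryGroup (Fin 2) ℂ)) (l : Edge d L) => -(ε' / (4 * κ')) • WithLp.toLp 2 (fun i : Fin 3 =>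
        fderiv ℝ (fun a : Edge d L → EuclideanSpace ℝ (Fin 3) => β * wilsonAction (Matrix.specialUnitaryGroup (Fin 2) ℂ).subtype ((layers.foldr (fun Ly (F : GaugeConfig d L (Matrix.specialUnitaryGroup (Fin 2) ℂ) ≃ᵐ GaugeConfig d L (Matrix.specialUnitaryGroup (Fin 2) ℂ)) => Ly.1.trans F) (MeasurableEquiv.refl (GaugeConfig d L (Matrix.specialUnitaryGroup (Fin 2) ℂ)))) ((fun l : Edge d L => expPauli (a l)) * V)) - Real.log ((layers.foldr (fun Ly K => fun v => Ly.2 v * K (Ly.1 v)) (fun _ => (1 : ℝ))) ((fun l : Edge d L => expPauli (a l)) * V))) 0 (Pi.single l (EuclideanSpace.single i (1 : ℝ))))) n (q, p)).1) - Real.log ((layers.foldr (fun Ly K => fun v => Ly.2 v * K (Ly.1 v)) (fun _ => (1 : ℝ))) (sunLeapfrogProposalN pauliCoordι pauliCoordι_skew ε' (fun (V : GaugeConfig d L (Matrix.specialUnitaryGroup (Fin 2) ℂ)) (l : Edge d L) => -(ε' / (4 * κ')) • WithLp.toLp 2 (fun i : Fin 3 =>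
        fderiv ℝ (fun a : Edge d L → EuclideanSpace ℝ (Fin 3) => β * wilsonAction (Matrix.specialUnitaryGroup (Fin 2) ℂ).subtype ((layers.foldr (fun Ly (F : GaugeConfig d L (Matrix.specialUnitaryGroup (Fin 2) ℂ) ≃ᵐ GaugeConfig d L (Matrix.specialUnitaryGroup (Fin 2) ℂ)) => Ly.1.trans F) (MeasurableEquiv.refl (GaugeConfig d L (Matrix.specialUnitaryGroup (Fin 2) ℂ)))) ((fun l : Edge d L => expPauli (a l)) * V)) - Real.log ((layers.foldr (fun Ly K => fun v => Ly.2 v * K (Ly.1 v)) (fun _ => (1 : ℝ))) ((fun l : Edge d L => expPauli (a l)) * V))) 0 (Pi.single l (EuclideanSpace.single i (1 : ℝ))))) n (q, p)).1) + su2Kinetic κ' (sunLeapfrogProposalN pauliCoordι pauliCoordι_skew ε' (fun (V : GaugeConfig d L (Matrix.specialUnitaryGroup (Fin 2) ℂ)) (l : Edge d L) => -(ε' / (4 * κ')) • WithLp.toLp 2 (fun i : Fin 3 =>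
        fderiv ℝ (fun a : Edge d L → EuclideanSpace ℝ (Fin 3) => β * wilsonAction (Matrix.specialUnitaryGroup (Fin 2) ℂ).subtype ((layers.foldr (fun Ly (F : GaugeConfig d L (Matrix.specialUnitaryGroup (Fin 2) ℂ) ≃ᵐ GaugeConfig d L (Matrix.specialUnitaryGroup (Fin 2) ℂ)) => Ly.1.trans F) (MeasurableEquiv.refl (GaugeConfig d L (Matrix.specialUnitaryGroup (Fin 2) ℂ)))) ((fun l : Edge d L => expPauli (a l)) * V)) - Real.log ((layers.foldr (fun Ly K => fun v => Ly.2 v * K (Ly.1 v)) (fun _ => (1 : ℝ))) ((fun l : Edge d L => expPauli (a l)) * V))) 0 (Pi.single l (EuclideanSpace.single i (1 : ℝ))))) n (q, p)).2) -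
          (β * wilsonAction (Matrix.specialUnitaryGroup (Fin 2) ℂ).subtype ((layers.foldr (fun Ly (F : GaugeConfig d L (Matrix.specialUnitaryGroup (Fin 2) ℂ) ≃ᵐ GaugeConfig d L (Matrix.specialUnitaryGroup (Fin 2) ℂ)) => Ly.1.trans F) (MeasurableEquiv.refl (GaugeConfig d L (Matrix.specialUnitaryGroup (Fin 2) ℂ)))) q) - Real.log ((layers.foldr (fun Ly K => fun v => Ly.2 v * K (Ly.1 v)) (fun _ => (1 : ℝ))) q) + su2Kinetic κ' p)| ≤
        n * ((|ε'| * KΦ) * (‖p‖ + (2 * n + 1) * (|ε'| * Φmax / (4 * κ'))) * |ε'| *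
          (8 * (∑ l, ‖p l‖ + (2 * n + 1) * (Fintype.card (Edge d L) * (|ε'| * Φmax / (4 * κ')))) +
            Fintype.card (Edge d L) * (|ε'| * Φmax) / κ')) := by
  obtain ⟨-, Φmax, KΦ, hΦ0, hK0, hb₁, hK₁⟩ := su2WilsonFlowLO_exactForce_regular χ ε sched layers hmap hpos β 1
  have hb : ∀ (V : GaugeConfig d L (Matrix.specialUnitaryGroup (Fin 2) ℂ)) (l : Edge d L), ‖WithLp.toLp 2 (fun i : Fin 3 =>
        fderiv ℝ (fun a : Edge d L → EuclideanSpace ℝ (Fin 3) => β * wilsonAction (Matrix.specialUnitaryGroup (Fin 2) ℂ).subtype ((layers.foldr (fun Ly (F : GaugeConfig d L (Matrix.specialUnitaryGroup (Fin 2) ℂ) ≃ᵐ GaugeConfig d L (Matrix.specialUnitaryGroup (Fin 2) ℂ)) => Ly.1.trans F) (MeasurableEquiv.refl (GaugeConfig d L (Matrix.specialUnitaryGroup (Fin 2) ℂ)))) ((fun l : Edge d L => expPauli (a l)) * V)) - Real.log ((layers.foldr (fun Ly K => fun v => Ly.2 v * K (Ly.1 v)) (fun _ => (1 : ℝ)))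 ((fun l : Edge d L => expPauli (a l)) * V))) 0 (Pi.single l (EuclideanSpace.single i (1 : ℝ))))‖ ≤ Φmax :=
    fun V l => by simpa only [one_smul] using hb₁ V l
  have hK : ∀ V V' : GaugeConfig d L (Matrix.specialUnitaryGroup (Fin 2) ℂ),
      ‖(fun l : Edge d L => WithLp.toLp 2 (fun i : Fin 3 =>
        fderiv ℝ (fun a : Edge d L → EuclideanSpace ℝ (Fin 3) => β * wilsonAction (Matrix.specialUnitaryGroup (Fin 2) ℂ).subtype ((layers.foldr (fun Ly (F : GaugeConfig d L (Matrix.specialUnitaryGroup (Fin 2) ℂ) ≃ᵐ GaugeConfig d L (Matrix.specialUnitaryGroup (Fin 2) ℂ)) => Ly.1.trans F) (MeasurableEquiv.refl (GaugeConfig d L (Matrix.specialUnitaryGroup (Fin 2) ℂ)))) ((fun l : Edge d L => expPauli (a l)) * V)) - Real.log ((layers.foldr (fun Ly K => fun v => Ly.2 v * K (Ly.1 v)) (fun _ => (1 : ℝ))) ((fun l : Edge d L => expPauli (a l)) * V))) 0 (Pi.single l (EuclideanSpace.single i (1 : ℝ))))) - (fun l : Edge d L => WithLp.toLp 2 (fun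 i : Fin 3 =>
        fderiv ℝ (fun a : Edge d L → EuclideanSpace ℝ (Fin 3) => β * wilsonAction (Matrix.specialUnitaryGroup (Fin 2) ℂ).subtype ((layers.foldr (fun Ly (F : GaugeConfig d L (Matrix.specialUnitaryGroup (Fin 2) ℂ) ≃ᵐ GaugeConfig d L (Matrix.specialUnitaryGroup (Fin 2) ℂ)) => Ly.1.trans F) (MeasurableEquiv.refl (GaugeConfig d L (Matrix.specialUnitaryGroup (Fin 2) ℂ)))) ((fun l : Edge d L => expPauli (a l)) * V')) - Real.log ((layers.foldr (fun Ly K => fun v => Ly.2 v * K (Ly.1 v)) (fun _ => (1 : ℝ))) ((fun l : Edge d L => expPauli (a l)) * V'))) 0 (Pi.single l (EuclideanSpace.single i (1 : ℝ)))))‖ ≤ KΦ * ‖coeConfig V - coeConfig V'‖ :=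
    fun V V' => by simpa only [one_smul] using hK₁ V V'
  have hd1 : ∀ W : GaugeConfig d L (Matrix.specialUnitaryGroup (Fin 2) ℂ),
      DifferentiableAt ℝ (fun a : Edge d L → EuclideanSpace ℝ (Fin 3) => β * wilsonAction (Matrix.specialUnitaryGroup (Fin 2) ℂ).subtype ((layers.foldr (fun Ly (F : GaugeConfig d L (Matrix.specialUnitaryGroup (Fin 2) ℂ) ≃ᵐ GaugeConfig d L (Matrix.specialUnitaryGroup (Fin 2) ℂ)) => Ly.1.trans F) (MeasurableEquiv.refl (GaugeConfig d L (Matrix.specialUnitaryGroup (Fin 2) ℂ)))) ((fun l : Edge d L => expPauli (a l)) * W)) - Real.log ((layers.foldr (fun Ly K => fun v => Ly.2 v * K (Ly.1 v)) (fun _ => (1 : ℝ))) ((fun l : Edge d L => expPauli (a l)) * W))) 0 :=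
    fun W => differentiableAt_ftAction_su2WilsonFlowLO_pauliDrift χ ε sched layers hmap hpos β W 0
  refine ⟨Φmax, KΦ, hΦ0, hK0, hb, hK, fun n ε' q p => ?_⟩
  exact abs_su2LeapfrogProposalN_energy_error_le_of_unitGrad
    (fun V : GaugeConfig d L (Matrix.specialUnitaryGroup (Fin 2) ℂ) => β * wilsonAction (Matrix.specialUnitaryGroup (Fin 2) ℂ).subtype ((layers.foldr (fun Ly (F : GaugeConfig d L (Matrix.specialUnitaryGroup (Fin 2) ℂ) ≃ᵐ GaugeConfig d L (Matrix.specialUnitaryGroup (Fin 2) ℂ)) => Ly.1.trans F) (MeasurableEquiv.refl (GaugeConfig d L (Matrix.specialUnitaryGroup (Fin 2) ℂ)))) V) - Real.log ((layers.foldr (fun Ly K => fun v => Ly.2 v * K (Ly.1 v)) (fun _ => (1 : ℝ))) V)) ε' κ' hκ' hd1 hΦ0 hK0 hb hK q p n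

end Member

/-! ## §4 The row's 4⁴ acceptance configuration -/

section Acceptance

/-- **THE ROW'S ACCEPTANCE CONFIGURATION WITH THE EXACT FORCE: the «acceptance vs step size» law.**  4⁴ `SU(2)`,
a parity colouring, Lüscher's sweep schedule (`8·nsweeps` masked LO sub-steps), refusal rule `6|ε| < 1`, every
`β`, `κ' > 0`: the layers exist as packaged, and the conclusion of
`su2WilsonFlowLO_exactForce_leapfrogN_energy_error` holds for them — the energy error of the `n`-step FT-HMC
proposal with the exact force (scale `1`) and the consistent half kick is `O(nε'²)` with every constant but the
two compactness constants `Φ_max, K_Φ` explicit. -/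
theorem su2_fthmcN_acceptanceLattice_exactForce_energy_error {ε : ℝ} (hε : |ε| * 6 < 1)
    (nsweeps : ℕ) (β κ' : ℝ) (hκ' : 0 < κ') :
    ∃ χ : Site 4 4 → ZMod 2, (∀ (x : Site 4 4) (i : Fin 4), χ (x.shift i) ≠ χ x) ∧
    ∃ layers : List ((GaugeConfig 4 4 (Matrix.specialUnitaryGroup (Fin 2) ℂ) ≃ᵐ GaugeConfig 4 4 (Matrix.specialUnitaryGroup (Fin 2) ℂ)) × (GaugeConfig 4 4 (Matrix.specialUnitaryGroup (Fin 2) ℂ) → ℝ)),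
      layers.map (fun Ly => ((Ly.1 : GaugeConfig 4 4 (Matrix.specialUnitaryGroup (Fin 2) ℂ) → GaugeConfig 4 4 (Matrix.specialUnitaryGroup (Fin 2) ℂ)), Ly.2)) =
        ((List.replicate nsweeps ((List.finRange 4).flatMap fun μ : Fin 4 => [(μ, (0 : ZMod 2)), (μ, 1)])).flatten).map (fun s =>
        ((fun (V : GaugeConfig 4 4 (Matrix.specialUnitaryGroup (Fin 2) ℂ)) (e : Edge 4 4) =>
        if e.2 = s.1 ∧ χ e.1 = s.2 then
          gaussUnit (geodesicKick ε (∑ ν ∈ Finset.univ.erase e.2,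
            (vecQuat (((V (Site.shift e.1 e.2, ν) * (V (Site.shift e.1 ν, e.2))⁻¹ * (V (e.1, ν))⁻¹)⁻¹ : (Matrix.specialUnitaryGroup (Fin 2) ℂ)) : Matrix (Fin 2) (Fin 2) ℂ) +
              vecQuat ((((V (Site.shift (e.1 - Pi.single ν 1) e.2, ν))⁻¹ * (V (e.1 - Pi.single ν 1, e.2))⁻¹ *
                V (e.1 - Pi.single ν 1, ν))⁻¹ : (Matrix.specialUnitaryGroup (Fin 2) ℂ)) : Matrix (Fin 2) (Fin 2) ℂ)))
            (vecQuat ((V e : (Matrix.specialUnitaryGroup (Fin 2) ℂ)) : Matrix (Fin 2) (Fin 2) ℂ)))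
        else V e),
         fun V : GaugeConfig 4 4 (Matrix.specialUnitaryGroup (Fin 2) ℂ) => ∏ a : {e : Edge 4 4 // e.2 = s.1 ∧ χ e.1 = s.2},
          (if Real.sin (angle (∑ ν ∈ Finset.univ.erase a.1.2,
            (vecQuat (((V (Site.shift a.1.1 a.1.2, ν) * (V (Site.shift a.1.1 ν, a.1.2))⁻¹ * (V (a.1.1, ν))⁻¹)⁻¹ : (Matrix.specialUnitaryGroup (Fin 2) ℂ)) : Matrix (Fin 2) (Fin 2) ℂ) +
              vecQuat ((((V (Site.shift (a.1.1 - Pi.single ν 1) a.1.2, ν))⁻¹ * (V (a.1.1 - Pi.single ν 1, a.1.2))⁻¹ *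
                V (a.1.1 - Pi.single ν 1, ν))⁻¹ : (Matrix.specialUnitaryGroup (Fin 2) ℂ)) : Matrix (Fin 2) (Fin 2) ℂ))) (vecQuat ((V a.1 : (Matrix.specialUnitaryGroup (Fin 2) ℂ)) : Matrix (Fin 2) (Fin 2) ℂ))) = 0 then
            (1 - ε * ‖(∑ ν ∈ Finset.univ.erase a.1.2,
            (vecQuat (((V (Site.shift a.1.1 a.1.2, ν) * (V (Site.shift a.1.1 ν, a.1.2))⁻¹ * (V (a.1.1, ν))⁻¹)⁻¹ : (Matrix.specialUnitaryGroup (Fin 2) ℂ)) : Matrix (Fin 2) (Fin 2) ℂ) +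
              vecQuat ((((V (Site.shift (a.1.1 - Pi.single ν 1) a.1.2, ν))⁻¹ * (V (a.1.1 - Pi.single ν 1, a.1.2))⁻¹ *
                V (a.1.1 - Pi.single ν 1, ν))⁻¹ : (Matrix.specialUnitaryGroup (Fin 2) ℂ)) : Matrix (Fin 2) (Fin 2) ℂ)))‖ * Real.cos (angle (∑ ν ∈ Finset.univ.erase a.1.2,
            (vecQuat (((V (Site.shift a.1.1 a.1.2, ν) * (V (Site.shift a.1.1 ν, a.1.2))⁻¹ * (V (a.1.1, ν))⁻¹)⁻¹ : (Matrix.specialUnitaryGroup (Fin 2) ℂ)) : Matrix (Fin 2) (Fin 2) ℂ) +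
              vecQuat ((((V (Site.shift (a.1.1 - Pi.single ν 1) a.1.2, ν))⁻¹ * (V (a.1.1 - Pi.single ν 1, a.1.2))⁻¹ *
                V (a.1.1 - Pi.single ν 1, ν))⁻¹ : (Matrix.specialUnitaryGroup (Fin 2) ℂ)) : Matrix (Fin 2) (Fin 2) ℂ))) (vecQuat ((V a.1 : (Matrix.specialUnitaryGroup (Fin 2) ℂ)) : Matrix (Fin 2) (Fin 2) ℂ)))) ^ 3
          else kickJac (ε * ‖(∑ ν ∈ Finset.univ.erase a.1.2,
            (vecQuat (((V (Site.shift a.1.1 a.1.2, ν) * (V (Site.shift a.1.1 ν, a.1.2))⁻¹ * (V (a.1.1, ν))⁻¹)⁻¹ : (Matrix.specialUnitaryGroup (Fin 2) ℂ)) : Matrix (Fin 2) (Fin 2) ℂ) +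
              vecQuat ((((V (Site.shift (a.1.1 - Pi.single ν 1) a.1.2, ν))⁻¹ * (V (a.1.1 - Pi.single ν 1, a.1.2))⁻¹ *
                V (a.1.1 - Pi.single ν 1, ν))⁻¹ : (Matrix.specialUnitaryGroup (Fin 2) ℂ)) : Matrix (Fin 2) (Fin 2) ℂ)))‖) 2 (angle (∑ ν ∈ Finset.univ.erase a.1.2,
            (vecQuat (((V (Site.shift a.1.1 a.1.2, ν) * (V (Site.shift a.1.1 ν, a.1.2))⁻¹ * (V (a.1.1, ν))⁻¹)⁻¹ : (Matrix.specialUnitaryGroup (Fin 2) ℂ)) : Matrix (Fin 2) (Fin 2) ℂ) +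
              vecQuat ((((V (Site.shift (a.1.1 - Pi.single ν 1) a.1.2, ν))⁻¹ * (V (a.1.1 - Pi.single ν 1, a.1.2))⁻¹ *
                V (a.1.1 - Pi.single ν 1, ν))⁻¹ : (Matrix.specialUnitaryGroup (Fin 2) ℂ)) : Matrix (Fin 2) (Fin 2) ℂ))) (vecQuat ((V a.1 : (Matrix.specialUnitaryGroup (Fin 2) ℂ)) : Matrix (Fin 2) (Fin 2) ℂ)))))) ∧
      layers.length = 8 * nsweeps ∧ (∀ Ly ∈ layers, ∀ V, 0 < Ly.2 V) ∧
    ∃ Φmax KΦ : ℝ, 0 ≤ Φmax ∧ 0 ≤ KΦ ∧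
      (∀ (V : GaugeConfig 4 4 (Matrix.specialUnitaryGroup (Fin 2) ℂ)) (l : Edge 4 4), ‖WithLp.toLp 2 (fun i : Fin 3 =>
        fderiv ℝ (fun a : Edge 4 4 → EuclideanSpace ℝ (Fin 3) => β * wilsonAction (Matrix.specialUnitaryGroup (Fin 2) ℂ).subtype ((layers.foldr (fun Ly (F : GaugeConfig 4 4 (Matrix.specialUnitaryGroup (Fin 2) ℂ) ≃ᵐ GaugeConfig 4 4 (Matrix.specialUnitaryGroup (Fin 2) ℂ)) => Ly.1.trans F) (MeasurableEquiv.refl (GaugeConfig 4 4 (Matrix.specialUnitaryGroup (Fin 2) ℂ)))) ((fun l : Edge 4 4 => expPauli (a l)) * V)) - Real.log ((layers.foldr (fun Ly K => fun v => Ly.2 v * K (Ly.1 v)) (fun _ => (1 : ℝ))) ((fun l : Edge 4 4 => expPauli (a l)) * V))) 0 (Pi.single l (EuclideanSpace.single i (1 : ℝ))))‖ ≤ Φmax) ∧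
      (∀ V V' : GaugeConfig 4 4 (Matrix.specialUnitaryGroup (Fin 2) ℂ),
        ‖(fun l : Edge 4 4 => WithLp.toLp 2 (fun i : Fin 3 =>
        fderiv ℝ (fun a : Edge 4 4 → EuclideanSpace ℝ (Fin 3) => β * wilsonAction (Matrix.specialUnitaryGroup (Fin 2) ℂ).subtype ((layers.foldr (fun Ly (F : GaugeConfig 4 4 (Matrix.specialUnitaryGroup (Fin 2) ℂ) ≃ᵐ GaugeConfig 4 4 (Matrix.specialUnitaryGroup (Fin 2) ℂ)) => Ly.1.trans F) (MeasurableEquiv.refl (GaugeConfig 4 4 (Matrix.specialUnitaryGroup (Fin 2) ℂ)))) ((fun l : Edge 4 4 => expPauli (a l)) * V)) - Real.log ((layers.foldr (fun Ly K => fun v => Ly.2 v * K (Ly.1 v)) (fun _ => (1 : ℝ))) ((fun l : Edge 4 4 => expPauli (a l)) * V))) 0 (Pi.single l (EuclideanSpace.single i (1 : ℝ))))) - (fun l : Edge 4 4 => WithLp.toLp 2 (fun i : Fin 3 =>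
        fderiv ℝ (fun a : Edge 4 4 → EuclideanSpace ℝ (Fin 3) => β * wilsonAction (Matrix.specialUnitaryGroup (Fin 2) ℂ).subtype ((layers.foldr (fun Ly (F : GaugeConfig 4 4 (Matrix.specialUnitaryGroup (Fin 2) ℂ) ≃ᵐ GaugeConfig 4 4 (Matrix.specialUnitaryGroup (Fin 2) ℂ)) => Ly.1.trans F) (MeasurableEquiv.refl (GaugeConfig 4 4 (Matrix.specialUnitaryGroup (Fin 2) ℂ)))) ((fun l : Edge 4 4 => expPauli (a l)) * V')) - Real.log ((layers.foldr (fun Ly K => fun v => Ly.2 v * K (Ly.1 v)) (fun _ => (1 : ℝ))) ((fun l : Edge 4 4 => expPauli (a l)) * V'))) 0 (Pi.single l (EuclideanSpace.single i (1 : ℝ)))))‖ ≤ KΦ * ‖coeConfig V - coeConfig V'‖) ∧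
      ∀ (n : ℕ) (ε' : ℝ) (q : GaugeConfig 4 4 (Matrix.specialUnitaryGroup (Fin 2) ℂ)) (p : Edge 4 4 → EuclideanSpace ℝ (Fin 3)),
        |(β * wilsonAction (Matrix.specialUnitaryGroup (Fin 2) ℂ).subtype ((layers.foldr (fun Ly (F : GaugeConfig 4 4 (Matrix.specialUnitaryGroup (Fin 2) ℂ) ≃ᵐ GaugeConfig 4 4 (Matrix.specialUnitaryGroup (Fin 2) ℂ)) => Ly.1.trans F) (MeasurableEquiv.refl (GaugeConfig 4 4 (Matrix.specialUnitaryGroup (Fin 2) ℂ)))) (sunLeapfrogProposalN pauliCoordι pauliCoordι_skew ε' (fun (V : GaugeConfig 4 4 (Matrix.specialUnitaryGroup (Fin 2) ℂ)) (l : Edge 4 4) => -(ε' / (4 * κ')) • WithLp.toLp 2 (fun i : Fin 3 =>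
        fderiv ℝ (fun a : Edge 4 4 → EuclideanSpace ℝ (Fin 3) => β * wilsonAction (Matrix.specialUnitaryGroup (Fin 2) ℂ).subtype ((layers.foldr (fun Ly (F : GaugeConfig 4 4 (Matrix.specialUnitaryGroup (Fin 2) ℂ) ≃ᵐ GaugeConfig 4 4 (Matrix.specialUnitaryGroup (Fin 2) ℂ)) => Ly.1.trans F) (MeasurableEquiv.refl (GaugeConfig 4 4 (Matrix.specialUnitaryGroup (Fin 2) ℂ)))) ((fun l : Edge 4 4 => expPauli (a l)) * V)) - Real.log ((layers.foldr (fun Ly K => fun v => Ly.2 v * K (Ly.1 v)) (fun _ => (1 : ℝ))) ((fun l : Edge 4 4 => expPauli (a l)) * V))) 0 (Pi.single l (EuclideanSpace.single i (1 : ℝ))))) n (q, p)).1) - Real.log ((layers.foldr (fun Ly K => fun v => Ly.2 v * K (Ly.1 v)) (fun _ => (1 : ℝ))) (sunLeapfrogProposalN pauliCoordι pauliCoordι_skew ε' (fun (V : GaugeConfig 4 4 (Matrix.specialUnitaryGroup (Fin 2) ℂ)) (l : Edge 4 4) => -(ε' / (4 * κ')) • WithLp.toLp 2 (fun i : Fin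 3 =>
        fderiv ℝ (fun a : Edge 4 4 → EuclideanSpace ℝ (Fin 3) => β * wilsonAction (Matrix.specialUnitaryGroup (Fin 2) ℂ).subtype ((layers.foldr (fun Ly (F : GaugeConfig 4 4 (Matrix.specialUnitaryGroup (Fin 2) ℂ) ≃ᵐ GaugeConfig 4 4 (Matrix.specialUnitaryGroup (Fin 2) ℂ)) => Ly.1.trans F) (MeasurableEquiv.refl (GaugeConfig 4 4 (Matrix.specialUnitaryGroup (Fin 2) ℂ)))) ((fun l : Edge 4 4 => expPauli (a l)) * V)) - Real.log ((layers.foldr (fun Ly K => fun v => Ly.2 v * K (Ly.1 v)) (fun _ => (1 : ℝ))) ((fun l : Edge 4 4 => expPauli (a l)) * V))) 0 (Pi.single l (EuclideanSpace.single i (1 : ℝ))))) n (q, p)).1) + su2Kinetic κ' (sunLeapfrogProposalN pauliCoordι pauliCoordι_skew ε' (fun (V : GaugeConfig 4 4 (Matrix.specialUnitaryGroup (Fin 2) ℂ)) (l : Edge 4 4) => -(ε' / (4 * κ')) • WithLp.toLp 2 (fun i : Fin 3 =>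
        fderiv ℝ (fun a : Edge 4 4 → EuclideanSpace ℝ (Fin 3) => β * wilsonAction (Matrix.specialUnitaryGroup (Fin 2) ℂ).subtype ((layers.foldr (fun Ly (F : GaugeConfig 4 4 (Matrix.specialUnitaryGroup (Fin 2) ℂ) ≃ᵐ GaugeConfig 4 4 (Matrix.specialUnitaryGroup (Fin 2) ℂ)) => Ly.1.trans F) (MeasurableEquiv.refl (GaugeConfig 4 4 (Matrix.specialUnitaryGroup (Fin 2) ℂ)))) ((fun l : Edge 4 4 => expPauli (a l)) * V)) - Real.log ((layers.foldr (fun Ly K => fun v => Ly.2 v * K (Ly.1 v)) (fun _ => (1 : ℝ))) ((fun l : Edge 4 4 => expPauli (a l)) * V))) 0 (Pi.single l (EuclideanSpace.single i (1 : ℝ))))) n (q, p)).2) -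
          (β * wilsonAction (Matrix.specialUnitaryGroup (Fin 2) ℂ).subtype ((layers.foldr (fun Ly (F : GaugeConfig 4 4 (Matrix.specialUnitaryGroup (Fin 2) ℂ) ≃ᵐ GaugeConfig 4 4 (Matrix.specialUnitaryGroup (Fin 2) ℂ)) => Ly.1.trans F) (MeasurableEquiv.refl (GaugeConfig 4 4 (Matrix.specialUnitaryGroup (Fin 2) ℂ)))) q) - Real.log ((layers.foldr (fun Ly K => fun v => Ly.2 v * K (Ly.1 v)) (fun _ => (1 : ℝ))) q) + su2Kinetic κ' p)| ≤
        n * ((|ε'| * KΦ) * (‖p‖ + (2 * n + 1) * (|ε'| * Φmax / (4 * κ'))) * |ε'| *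
          (8 * (∑ l, ‖p l‖ + (2 * n + 1) * (Fintype.card (Edge 4 4) * (|ε'| * Φmax / (4 * κ')))) +
            Fintype.card (Edge 4 4) * (|ε'| * Φmax) / κ')) := by
  obtain ⟨χ, hχ⟩ := exists_parityMask (d := 4) (L := 4) (by decide)
  have hε' : |ε| * (2 * ((4 - 1 : ℕ) : ℝ)) < 1 := by norm_num; linarith
  obtain ⟨layers, hmap, hpos, -, -⟩ := exists_layers_su2WilsonFlowLO χ hχ hε'
    ((List.replicate nsweeps ((List.finRange 4).flatMap fun μ : Fin 4 => [(μ, (0 : ZMod 2)), (μ, 1)])).flatten)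
  have hlen : layers.length = 8 * nsweeps := by
    have h := congrArg List.length hmap
    rw [List.length_map, List.length_map, length_luscherSchedule_four] at h
    exact h
  exact ⟨χ, hχ, layers, hmap, hlen, hpos,
    su2WilsonFlowLO_exactForce_leapfrogN_energy_error χ ε ((List.replicate nsweeps ((List.finRange 4).flatMap fun μ : Fin 4 => [(μ, (0 : ZMod 2)), (μ, 1)])).flatten) layers hmap hpos β κ' hκ'⟩

end Acceptance

end Summit.Ventures.LatticeQCDFlow.Exactness
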